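import Summits.QuantumFields.YangMills.Theorems.UnitScaleTiltFluctuationComparisonRegPrRepAtHeightsV3FamBase
import Literature.MathematicalPhysics.QuantumFieldTheory.Balaban1983to89.T3AlphaInputsACTwoRunLevel
import HarnessLib

/-!
# `UnitScaleTiltFluctuationComparisonRegPrGlobalSlackCanonicalPolymers` — THE CANONICAL POLYMERISATION OF A v3 FAMILY AND (43) AT THE TRIVIAL HISTORY AS A THEOREM
# (crux `FluctuationComparisonRegPrL`, stmt-QuantumFields-19935, STUB 3⁗ `stub_globalTwoRunSlackFam`; width-lever lane A, the producer's first row)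

Seat ym-ust-19935-slack g0 (prover).  The local→global producer of the K1a line (`GlobalSlackLocalToGlobal.globalTwoRunSlackTail_of_polymerSlack`, p530498) reads
the datum `AlphaInputsT3AC.dataOfV3 p π` of a family of v3 packages `p : ∀ K, PkgAtV3 F 𝔠 γ hγ hγ1 K` through a polymer parameter `π` and a coarse-field term function
`PT`, and its FIRST hypothesis is the (43) decomposition at the trivial history, `PintDecompTrivT (dataOfV3 p π) PT`.  Until now `π` and `PT` were free parameters.
This file DEFINES them from the package's own expansion data (`Carriers.StepSeries`, the lane pub-balaban3d's record) and PROVES that row: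

* §1 point sets: `blockSet K i y` (the fine sites of run `K` coarsening to the level-`i` site `y`) and `domSet M₁ K k X` (the fine sites whose scale-`k` big block
  lies in the block set `X.1` of a `tsys`-domain `X` — the point set of a localisation domain of (59));
* §2 THE CANONICAL POLYMERISATION `canonPolymer p : AlphaInputsT3AC.PolymerT3 F`: at lattice level `k+1` of run `K`, the NEW terms (term level `k+1`) are
  localised in the retained domains `(p K).𝔖 k).loc …` of (59) (point sets `domSet`), the OLD terms of level `i ≤ k` are localised block by block
  (`Carriers.oldBlocks`, point sets `blockSet`) — the (43) index set of the lane grouped by its block `y`; levels above the top `K` get one dummy domain;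
  tree length = the infimum of `tsys.dj` over the domains with the given point set (so `0` on block domains); `Pterm`/`enl` are placeholders (the fine-field
  currency is not read by the T-socket);
* §3 THE CANONICAL TERM FUNCTION `canonPT p : TermFn F`: new terms = `Re jet26(Ψ_X)(Bcfg_X(triv, W)) − far_X` for the TWO displayed chart families `(p K).𝔖 k).Ψ`
  and `((p K).𝔄.Λc k).Ψ` (rows `hPY`/`hPYZ`), summed over the domains with the given point set; old terms = the lane's `oldVal` at the trivial history summed over
  degrees and bonds of the block (`Carriers.oldSumIn`'s summand);
* §4 **`pintDecompTrivT_canon : PintDecompTrivT (dataOfV3 p (canonPolymer p)) (canonPT p)`** — (43) p.266 «Σ_{j=1}^{k} Σ_{Y_j} 𝒫_j(Y_j, U_k)» at the trivial history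
  for EVERY family of v3 packages: `pintOfSeries` (`Pint (k+1) = PoldIn_k + PY_k + PYZ_k`, definitional) + the displayed identifications `hPY`/`hPYZ` of
  `StepAlphaV3AC` (k < K) + fibrewise re-indexing.  No estimate; nothing of [Balaban1985UV3] is asserted beyond the package's own rows.
What this is NOT: the other four producer rows (`LocCover`, `LocBlockVolume`, `LocMatched`, `TermSizeTrivT`) for `canonPolymer` — geometry of `tsys`/`refineSet`
and the sizes (44)/(34); nor the chart rows (REPORT-K1a-display-g0: (M1) is missing for the old levels).

References: T. Bałaban, CMP 102 (1985) 255–275 [Balaban1985UV3] ((24) p.262, (33) p.264, (43) p.266, (58)–(59) p.270, p.272); CMP 109 (1987) 249–301 [Balaban1987RG1] ((0.1) p.251).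
-/

set_option autoImplicit false

noncomputable section

namespace Summit.QuantumFields.YangMills.Theorems.GlobalSlackCanonicalPolymers

open scoped BigOperators
open Finset
open Literature.MathematicalPhysics.QuantumFieldTheory.Balaban1983to89
open Literature.MathematicalPhysics.QuantumFieldTheory.Balaban1983to89.T3ContinuumYM3Torus
open Literature.MathematicalPhysics.QuantumFieldTheory.Balaban1983to89.T3AlphaInputsAC
open Literature.MathematicalPhysics.QuantumFieldTheory.Balaban1983to89.T3AlphaInputsACTwoRunLevel
open Literature.MathematicalPhysics.QuantumFieldTheory.Balaban1983to89.TreeLengthTorus (tsys)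
open Literature.MathematicalPhysics.QuantumFieldTheory.Balaban1985CMP102
open Literature.MathematicalPhysics.QuantumFieldTheory.Balaban1985CMP102.Setting
open Summit.QuantumFields.Balaban3D.Carriers
open Summit.QuantumFields.Balaban3D.Proofs.Primitives
open Summit.QuantumFields.Balaban3D.Proofs.Representation33 (jet26)
open Summit.QuantumFields.YangMills.Theorems

variable {F : T3Family} {𝔠 : AlphaConsts F.L (suGroupModel 2).N} {γ : ℝ} {hγ : 0 < γ} {hγ1 : γ ≤ (min 𝔠.gamma0 1) ^ 2}

/-- The lane's scales of run `K` (abbreviation). [cite: Balaban1985UV3, (1)–(2) p.256] -/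
abbrev SK (F : T3Family) (𝔠 : AlphaConsts F.L (suGroupModel 2).N) (γ : ℝ) (hγ : 0 < γ) (hγ1 : γ ≤ (min 𝔠.gamma0 1) ^ 2) (K : ℕ) : Scales F.L :=
  T3Scales F γ hγ (hγ1.trans (sq_min_one_le _ 𝔠.gamma0_pos)) K

/-! ## §1 Point sets -/

/-- THE BLOCK OF A LEVEL-`i` SITE AS A POINT SET: the fine sites of run `K` whose `i`-fold block map is `y`. [cite: Balaban1987RG1, (0.1) p.251] -/
def blockSet (K i : ℕ) (y : Site (F.P K) i) : Set (Site (F.P K) 0) := {x | coarsen i x = y}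

/-- THE POINT SET OF A `tsys`-DOMAIN AT SCALE `k`: the fine sites whose scale-`k` big-block label (`Carriers.bigBlockOf`, `M₁`-cubes of `T^{(k)}`) is one of the
blocks of `X` — (59) «localizations X ⊂ Ω_{k+1}, which are connected unions of big blocks», read as a subset of the fine torus. [cite: Balaban1985UV3, (59) p.270] -/
def domSet (M₁ : ℕ) (K k : ℕ) {N : ℕ} [NeZero N] (X : (tsys 3 N).Dom) : Set (Site (F.P K) 0) :=
  {x | ∃ b ∈ X.1, bigBlockOf M₁ k x = fun μ => ((b : Fin 3 → ZMod N) μ).val}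

variable (p : ∀ K, AlphaInputsT3AC.PkgAtV3 F 𝔠 γ hγ hγ1 K)

/-- The retained localisation domains of the new terms born at step `k` of run `K`, history `h` ((59): inside `Ω_{k+1}(h)`, tree length `< R₁r(g_k)`). [cite: Balaban1985UV3, (59) p.270] -/
abbrev newDoms (K k : ℕ) (h : Hist (F.P K) (k + 1)) : Finset (tsys 3 (nblkOf (SK F 𝔠 γ hγ hγ1 K) 𝔠.lane.carrier k)).Dom :=
  ((p K).𝔖 k).loc (ΩblkOf 𝔠.lane.carrier.M₁ (rcolOf (SK F 𝔠 γ hγ hγ1 K) 𝔠.lane.carrier) (nblkOf (SK F 𝔠 γ hγ hγ1 K) 𝔠.lane.carrier k))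
    (rretOf (SK F 𝔠 γ hγ hγ1 K) 𝔠.lane.carrier k) h

/-! ## §2 The canonical polymerisation -/

open Classical in
/-- THE LOCALISATION DOMAINS OF THE CANONICAL POLYMERISATION of run `K` at lattice level `j`, history `h`, term level `i`: no terms at level `0`; at level `k+1`,
the new terms (`i = k+1`) in the point sets of the retained domains, the old terms (`1 ≤ i ≤ k`) block by block; above the top (`K < k+1`, where the package
has no step rows and no socket row reads) ONE dummy domain (the whole torus) at term level `1`, so that the volume row holds there too. [cite: Balaban1985UV3, (43) p.266, (59) p.270] -/
def canonLoc (K j : ℕ) (h : Hist (F.P K) j) (i : ℕ) : Finset (Set (Site (F.P K) 0)) :=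
  match j, h with
  | 0, _ => ∅
  | k + 1, h =>
    if k + 1 ≤ K then
      (if i = k + 1 then (newDoms p K k h).image (domSet (F := F) 𝔠.lane.carrier.M₁ K k)
       else if i ∈ Finset.Icc 1 k then
         (oldBlocks 𝔠.lane.carrier.M₁ (rcolOf (SK F 𝔠 γ hγ hγ1 K) 𝔠.lane.carrier) h i).image (blockSet K i)
       else ∅)
    else (if i = 1 then {Set.univ} else ∅)

open Classical in
/-- THE TREE LENGTH of a point set at term level `i` of run `K`: the infimum of `tsys.dj` over the step-`(i−1)` domains with that point set (`0` if there is none —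
block domains). [cite: Balaban1985UV3, (24)–(25) p.262, (59) p.270] -/
def canonTreeLen (K i : ℕ) (Y : Set (Site (F.P K) 0)) : ℝ :=
  sInf ((fun X => (tsys 3 ((p K).𝔖 (i - 1)).Nblk).dj X) ''
    {X : (tsys 3 ((p K).𝔖 (i - 1)).Nblk).Dom | domSet (F := F) 𝔠.lane.carrier.M₁ K (i - 1) X = Y})

/-- **THE CANONICAL POLYMERISATION OF THE FAMILY `p`** as a polymer parameter of the interface: `Loc := canonLoc`, `treeLen := canonTreeLen`; the fine-field term
`Pterm` and the enlargement `enl` are PLACEHOLDERS (`0`, `id`) — the coarse-field T-socket of 3⁗ (`PintDecompTrivT`/`TermSizeTrivT`/`PolymerCauchyMinAtT…`) never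
reads them. [cite: Balaban1985UV3, (43) p.266] -/
def canonPolymer : AlphaInputsT3AC.PolymerT3 F where
  Loc := canonLoc p
  Pterm := fun _ _ _ _ => 0
  enl := fun _ _ Y => Y
  treeLen := canonTreeLen p

/-! ## §3 The canonical term function -/

/-- THE NEW TERM OF A RETAINED DOMAIN at the trivial history: `Re jet26(Ψ_X)(B_X(triv, W)) − far_X(triv, W)` for the step charts AND the G3D-07 charts `Λc`
(the summands of `hPY` and `hPYZ`). [cite: Balaban1985UV3, (33) p.264, (60)–(61) p.271] -/
def newTerm (K k : ℕ) (X : (tsys 3 (nblkOf (SK F 𝔠 γ hγ hγ1 K) 𝔠.lane.carrier k)).Dom)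
    (W : GaugeField (F.P K) (k + 1) (Matrix.specialUnitaryGroup (Fin 2) ℂ)) : ℝ :=
  ((jet26 (((p K).𝔖 k).Ψ X) (((p K).𝔖 k).Bcfg X (Hist.triv (F.P K) (k + 1)) W)).re - ((p K).𝔖 k).far X (Hist.triv (F.P K) (k + 1)) W) +
  ((jet26 (((p K).𝔄.Λc k).Ψ X) (((p K).𝔖 k).Bcfg X (Hist.triv (F.P K) (k + 1)) W)).re - ((p K).𝔄.Λc k).far X (Hist.triv (F.P K) (k + 1)) W)

/-- THE OLD TERM OF A BLOCK at the trivial history: the lane's `oldVal` of level `i`, block `y`, summed over degrees `n ≤ Ndeg i` and bond tuples in the collar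
(`Carriers.oldSumIn`'s summand; nothing is dropped at the trivial history). [cite: Balaban1985UV3, (43) p.266, (58) p.270] -/
def oldTerm (K k i : ℕ) (y : Site (F.P K) i) (W : GaugeField (F.P K) (k + 1) (Matrix.specialUnitaryGroup (Fin 2) ℂ)) : ℝ :=
  ∑ n ∈ range (((p K).𝔖 k).Ndeg i + 1),
    ∑ c ∈ Fintype.piFinset (fun _ : Fin n => oldBonds 𝔠.lane.carrier.M₁ (rcolOf (SK F 𝔠 γ hγ hγ1 K) 𝔠.lane.carrier) (Hist.triv (F.P K) (k + 1)) i y),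
      (if Drop 𝔠.lane.carrier.M₁ (rcolOf (SK F 𝔠 γ hγ hγ1 K) 𝔠.lane.carrier) (Hist.triv (F.P K) (k + 1)) i y n c then 0
       else ((p K).𝔖 k).oldVal (Hist.triv (F.P K) (k + 1)) W i y n c)

open Classical in
/-- **THE CANONICAL TERM FUNCTION OF THE FAMILY `p`** (coarse-field-indexed, trivial history): at lattice level `k+1` of run `K`, the level-`(k+1)` term of a point set
`Y` is the sum of the new terms of the retained domains with point set `Y`, the level-`i ≤ k` term of `Y` is the sum of the old terms of the blocks with point set
`Y`; above the top the whole `Pint` sits on the dummy domain at term level `1`. [cite: Balaban1985UV3, (43) p.266] -/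
def canonPT : TermFn F := fun K j i Y W =>
  match j, W with
  | 0, _ => 0
  | k + 1, W =>
    if k + 1 ≤ K then
      (if i = k + 1 then
         ∑ X ∈ (newDoms p K k (Hist.triv (F.P K) (k + 1))).filter (fun X => domSet (F := F) 𝔠.lane.carrier.M₁ K k X = Y), newTerm p K k X W
       else
         ∑ y ∈ (oldBlocks 𝔠.lane.carrier.M₁ (rcolOf (SK F 𝔠 γ hγ hγ1 K) 𝔠.lane.carrier) (Hist.triv (F.P K) (k + 1)) i).filter
           (fun y => blockSet K i y = Y), oldTerm p K k i y W)
    else (if i = 1 then (p K).T.Pint (k + 1) (Hist.triv (F.P K) (k + 1)) W else 0)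

/-! ## §4 (43) at the trivial history for the canonical polymerisation — a theorem -/

/-- `Pint` of the package's tower at level `k+1` IS `PoldIn_k + PY_k + PYZ_k` (`Carriers.pintOfSeries`, definitional). [cite: Balaban1985UV3, (43) p.266] -/
theorem pint_succ_eq (K k : ℕ) (h : Hist (F.P K) (k + 1)) (U : GaugeField (F.P K) (k + 1) (Matrix.specialUnitaryGroup (Fin 2) ℂ)) :
    (p K).T.Pint (k + 1) h U =
      ((p K).𝔖 k).PoldIn 𝔠.lane.carrier.M₁ (rcolOf (SK F 𝔠 γ hγ hγ1 K) 𝔠.lane.carrier) h U + ((p K).𝔖 k).PY h U + ((p K).𝔖 k).PYZ h U :=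
  rfl

/-- `Pint` of the package's tower at level `0` vanishes (definitional). [cite: Balaban1985UV3, (1) p.256] -/
theorem pint_zero_eq (K : ℕ) (h : Hist (F.P K) 0) (U : GaugeField (F.P K) 0 (Matrix.specialUnitaryGroup (Fin 2) ℂ)) :
    (p K).T.Pint 0 h U = 0 :=
  rfl

open Classical in
/-- The old slice regrouped by blocks: `PoldIn_k(triv, W) = Σ_{i=1}^{k} Σ_{Y ∈ canonLoc (k+1) triv i} canonPT (k+1) i Y W`. [cite: Balaban1985UV3, (43) p.266, (58) p.270] -/
theorem poldIn_triv_eq_sum (K k : ℕ) (hk : k + 1 ≤ K) (W : GaugeField (F.P K) (k + 1) (Matrix.specialUnitaryGroup (Fin 2) ℂ)) :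
    ((p K).𝔖 k).PoldIn 𝔠.lane.carrier.M₁ (rcolOf (SK F 𝔠 γ hγ hγ1 K) 𝔠.lane.carrier) (Hist.triv (F.P K) (k + 1)) W =
      ∑ i ∈ Icc 1 k, ∑ Y ∈ canonLoc p K (k + 1) (Hist.triv (F.P K) (k + 1)) i, canonPT p K (k + 1) i Y W := by
  unfold StepSeries.PoldIn oldSumIn
  refine Finset.sum_congr rfl fun i hi => ?_
  have hik : i ≠ k + 1 := by have := (Finset.mem_Icc.mp hi).2; omega
  have hloc : canonLoc p K (k + 1) (Hist.triv (F.P K) (k + 1)) i =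
      (oldBlocks 𝔠.lane.carrier.M₁ (rcolOf (SK F 𝔠 γ hγ hγ1 K) 𝔠.lane.carrier) (Hist.triv (F.P K) (k + 1)) i).image (blockSet K i) := by
    simp only [canonLoc, if_pos hk, if_neg hik, if_pos hi]
  have hPT : ∀ Y, canonPT p K (k + 1) i Y W =
      ∑ y' ∈ (oldBlocks 𝔠.lane.carrier.M₁ (rcolOf (SK F 𝔠 γ hγ hγ1 K) 𝔠.lane.carrier) (Hist.triv (F.P K) (k + 1)) i).filter
        (fun y' => blockSet K i y' = Y), oldTerm p K k i y' W := fun Y => by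
    simp only [canonPT, if_pos hk, if_neg hik]
  rw [hloc, Finset.sum_image' (fun y => oldTerm p K k i y W) (fun y _ => hPT (blockSet K i y))]
  rfl

open Classical in
/-- The new slice regrouped by point sets, `k < K`: `PY_k + PYZ_k = Σ_{Y ∈ canonLoc (k+1) triv (k+1)} canonPT (k+1) (k+1) Y W` — the displayed identifications
`hPY`/`hPYZ` of the step rows and fibrewise re-indexing. [cite: Balaban1985UV3, (33) p.264, (59)–(61) pp.270–271] -/
theorem new_triv_eq_sum (K k : ℕ) (hk : k + 1 ≤ K) (W : GaugeField (F.P K) (k + 1) (Matrix.specialUnitaryGroup (Fin 2) ℂ)) :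
    ((p K).𝔖 k).PY (Hist.triv (F.P K) (k + 1)) W + ((p K).𝔖 k).PYZ (Hist.triv (F.P K) (k + 1)) W =
      ∑ Y ∈ canonLoc p K (k + 1) (Hist.triv (F.P K) (k + 1)) (k + 1), canonPT p K (k + 1) (k + 1) Y W := by
  have hloc : canonLoc p K (k + 1) (Hist.triv (F.P K) (k + 1)) (k + 1) =
      (newDoms p K k (Hist.triv (F.P K) (k + 1))).image (domSet (F := F) 𝔠.lane.carrier.M₁ K k) := by
    simp only [canonLoc, if_pos hk, ite_true]
  have hPT : ∀ Y, canonPT p K (k + 1) (k + 1) Y W =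
      ∑ X' ∈ (newDoms p K k (Hist.triv (F.P K) (k + 1))).filter (fun X' => domSet (F := F) 𝔠.lane.carrier.M₁ K k X' = Y),
        newTerm p K k X' W := fun Y => by
    simp only [canonPT, if_pos hk, ite_true]
  have hre : ∑ Y ∈ (newDoms p K k (Hist.triv (F.P K) (k + 1))).image (domSet (F := F) 𝔠.lane.carrier.M₁ K k),
      canonPT p K (k + 1) (k + 1) Y W = ∑ X ∈ newDoms p K k (Hist.triv (F.P K) (k + 1)), newTerm p K k X W :=
    Finset.sum_image' (fun X => newTerm p K k X W) (fun X _ => hPT (domSet (F := F) 𝔠.lane.carrier.M₁ K k X))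
  have h1 := ((p K).run.steps k hk).hPY (Hist.triv (F.P K) (k + 1)) W
  have h2 := ((p K).run.steps k hk).hPYZ (Hist.triv (F.P K) (k + 1)) W
  rw [hloc, hre, h1, h2, ← Finset.sum_add_distrib]
  exact Finset.sum_congr rfl fun X _ => rfl

open Classical in
/-- **(43) AT THE TRIVIAL HISTORY FOR THE CANONICAL POLYMERISATION — A THEOREM FOR EVERY FAMILY OF v3 PACKAGES**: `PintDecompTrivT (dataOfV3 p (canonPolymer p)) (canonPT p)`,
i.e. `Pint K j triv W = Σ_{i=1}^{j} Σ_{Y ∈ Loc K j triv i} canonPT K j i Y W` for every run, level and field — the producer's first row, discharged.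
[cite: Balaban1985UV3, (43) p.266, (58)–(61) pp.270–271] -/
theorem pintDecompTrivT_canon : PintDecompTrivT (AlphaInputsT3AC.dataOfV3 p (canonPolymer p)) (canonPT p) := by
  intro K j W
  show (p K).T.Pint j (Hist.triv (F.P K) j) W = ∑ i ∈ Icc 1 j, ∑ Y ∈ canonLoc p K j (Hist.triv (F.P K) j) i, canonPT p K j i Y W
  cases j with
  | zero => simp [pint_zero_eq]
  | succ k =>
    by_cases hk : k + 1 ≤ K
    · rw [pint_succ_eq, Finset.sum_Icc_succ_top (by omega : 1 ≤ k + 1), ← poldIn_triv_eq_sum p K k hk, add_assoc,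
        new_triv_eq_sum p K k hk W]
    · -- above the top: the whole `Pint` on the dummy domain at term level `1`
      rw [Finset.sum_eq_single_of_mem 1 (Finset.mem_Icc.mpr ⟨le_rfl, by omega⟩) (fun i _ hi1 => by
        simp only [canonLoc, if_neg hk, if_neg hi1, Finset.sum_empty])]
      simp only [canonLoc, canonPT, if_neg hk, ite_true, Finset.sum_singleton]

end Summit.QuantumFields.YangMills.Theorems.GlobalSlackCanonicalPolymers

end
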